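import Summits.Ventures.PercRepro.S1FourCircuitCountSharpB

/-!
# PercRepro — THE SHARP FOUR-CIRCUIT COUNT AT BOUNDED NULLITY, PART C: `3·s₄ ≤ ν³ + 11ν` under «planes ≤ 6» (p8, gen 19; a
feeder for S4 — the top of the `q = 7` window, the rows `66` and below)

* **`ncard_fourThrough_add_le_sq_add_four`** — the `4`-circuits through `e` under «planes ≤ 6»: `#{…} + ν ≤ ν² + 4` (they
  inject into the triangles of `M ／ {e}`, whose lines have `≤ 5` points — Part B);
* **`three_mul_ncard_four_circuits_le_sharp`** — `3·s₄ ≤ ν³ + 11ν` by the deletion induction of LEMMA T4 with the sharp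
  count through the deleted point (against `ν(ν+1)(ν+2)`: `1 424` against `1 632` at `ν = 16`, `12 100` against `13 090`
  at `ν = 33` — the cells `(66, 16)` and `(66, 33)` of the level-`7` chain).
Axioms: standard.
-/

open scoped Matroid

namespace PercRepro

namespace S1

open Set

variable {α : Type}

/-- **The `4`-circuits through a point, the rank-`3` sets with `≤ 6` points, SHARP**: `#{4-circuits through e} + d ≤ d² + 4` —
they inject (`C ↦ C ∖ {e}`) into the triangles of `M ／ {e}`, whose rank-`≤ 2` sets have `≤ 5` points
(`ncard_triangles_add_le_sq_add_four`). -/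
theorem ncard_fourThrough_add_le_sq_add_four (M : Matroid α) [M.Finite]
    (hflat : ∀ X ⊆ M.E, M.eRk X ≤ 3 → X.ncard ≤ 6) {e : α} (heI : M.Indep {e}) {d : ℕ}
    (hd : M.E.encard = M.eRank + d) :
    {C : Set α | M.IsCircuit C ∧ C.ncard = 4 ∧ e ∈ C}.ncard + d ≤ d * d + 4 := by
  classical
  have heE : e ∈ M.E := heI.subset_ground (mem_singleton e)
  have hν : M✶.eRank = (d : ℕ∞) := dual_eRank_eq_of_encard M hd
  set N := M ／ {e} with hN
  have hNd : N.E.encard = N.eRank + d := by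
    apply encard_eq_of_dual_eRank
    rw [hN, PercRepro.Matroid.dual_eRank_contract_singleton heI, hν]
  have hNE : N.E = M.E \ {e} := _root_.Matroid.contract_ground M {e}
  have hN' : ∀ L ⊆ N.E, N.eRk L ≤ 2 → L.ncard ≤ 5 := by
    intro L hL hr
    rw [hNE] at hL
    have heL : e ∉ L := fun h => (hL h).2 rfl
    have hLfin : L.Finite := M.ground_finite.subset (hL.trans sdiff_subset)
    have hins : M.eRk (insert e L) ≤ 3 := by
      have h := contract_singleton_eRk_add_one heI hL
      rw [← hN] at h
      rw [← h]
      calc N.eRk L + 1 ≤ 2 + 1 := add_le_add_left hr 1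
        _ = 3 := by norm_num
    have hb := hflat (insert e L) (insert_subset heE (hL.trans sdiff_subset)) hins
    rw [ncard_insert_of_notMem heL hLfin] at hb
    omega
  set S₁ := {C : Set α | M.IsCircuit C ∧ C.ncard = 4 ∧ e ∈ C} with hS₁
  let f : Set α → Set α := fun C => C \ {e}
  have hmaps : ∀ C ∈ S₁, f C ∈ ThmN.triangles N := by
    intro C hC
    have hCfin : C.Finite := M.ground_finite.subset hC.1.subset_ground
    refine ⟨hC.1.contractElem_isCircuit ?_ hC.2.2, ?_⟩
    · have h1lt : 1 < C.ncard := by rw [hC.2.1]; omega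
      obtain ⟨x, hx, y, hy, hxy⟩ := (one_lt_ncard hCfin).1 h1lt
      exact ⟨x, hx, y, hy, hxy⟩
    · have h3 := ncard_sdiff_singleton_add_one hC.2.2 hCfin
      have h4 := hC.2.1
      simp only [f]
      omega
  have hinj : InjOn f S₁ := by
    intro C hC C' hC' h
    have e1 : C = insert e (C \ {e}) := by rw [insert_sdiff_singleton, insert_eq_of_mem hC.2.2]
    have e2 : C' = insert e (C' \ {e}) := by rw [insert_sdiff_singleton, insert_eq_of_mem hC'.2.2]
    rw [e1, e2]
    simp only [f] at h
    rw [h]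
  have hle : S₁.ncard ≤ (ThmN.triangles N).ncard :=
    ncard_le_ncard_of_injOn f hmaps hinj
      (N.ground_finite.finite_subsets.subset (fun C hC => hC.1.subset_ground))
  have hinner := ncard_triangles_add_le_sq_add_four N hN' hNd
  omega

/-- **THE SHARP FOUR-CIRCUIT COUNT at bounded nullity.** If `|E| = r(E) + d` and every rank-`≤ 3` set has at most `6`
points, then `3·s₄ ≤ d³ + 11d`. Deletion induction on `|E|`: the `4`-circuits through a point `e` of some `4`-circuit number
at most `d² − d + 4` (`ncard_fourThrough_add_le_sq_add_four`), the others are the `4`-circuits of `M ＼ {e}`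
(nullity `d − 1`): `3·s₄ ≤ 3(d² − d + 4) + (d − 1)³ + 11(d − 1) = d³ + 11d`. -/
theorem three_mul_ncard_four_circuits_le_sharp (M : Matroid α) [M.Finite]
    (hflat : ∀ X ⊆ M.E, M.eRk X ≤ 3 → X.ncard ≤ 6) {d : ℕ} (hd : M.E.encard = M.eRank + d) :
    3 * {C : Set α | M.IsCircuit C ∧ C.ncard = 4}.ncard ≤ d * d * d + 11 * d := by
  suffices H : ∀ n : ℕ, ∀ (M : Matroid α) [M.Finite], M.E.ncard = n →
      (∀ X ⊆ M.E, M.eRk X ≤ 3 → X.ncard ≤ 6) → ∀ d : ℕ, M.E.encard = M.eRank + d →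
      3 * {C : Set α | M.IsCircuit C ∧ C.ncard = 4}.ncard ≤ d * d * d + 11 * d from H _ M rfl hflat d hd
  intro n
  induction n using Nat.strong_induction_on with
  | _ n ih =>
  intro M _ hn hflat d hd
  classical
  set S := {C : Set α | M.IsCircuit C ∧ C.ncard = 4} with hS
  have hSfin : S.Finite :=
    M.ground_finite.finite_subsets.subset (fun C hC => hC.1.subset_ground)
  by_cases hSe : S = ∅
  · rw [hSe, ncard_empty]; exact Nat.zero_le _
  obtain ⟨C₀, hC₀⟩ := nonempty_iff_ne_empty.2 hSe
  obtain ⟨e, heC₀⟩ := hC₀.1.nonempty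
  have heE : e ∈ M.E := hC₀.1.subset_ground heC₀
  have hne : ¬ M.IsColoop e := hC₀.1.not_isColoop_of_mem heC₀
  have hν : M✶.eRank = (d : ℕ∞) := dual_eRank_eq_of_encard M hd
  have hdel := PercRepro.Matroid.dual_eRank_delete_singleton_add_one heE hne
  rw [hν] at hdel
  have hfin' : (M ＼ {e})✶.eRank ≠ ⊤ := by
    intro h
    rw [h] at hdel
    exact absurd hdel (by simp)
  obtain ⟨d', hd'⟩ := ENat.ne_top_iff_exists.1 hfin'
  have hdd' : d = d' + 1 := by
    rw [← hd'] at hdel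
    exact_mod_cast hdel.symm
  have hd'enc : (M ＼ {e}).E.encard = (M ＼ {e}).eRank + d' := encard_eq_of_dual_eRank _ hd'.symm
  have hdelE : (M ＼ {e}).E.ncard < n := by
    rw [_root_.Matroid.delete_ground, ← hn, ← ncard_sdiff_singleton_add_one heE M.ground_finite]
    omega
  have hflat' : ∀ X ⊆ (M ＼ {e}).E, (M ＼ {e}).eRk X ≤ 3 → X.ncard ≤ 6 := by
    intro X hX hr
    rw [_root_.Matroid.delete_ground] at hX
    rw [delete_singleton_eRk_eq hX] at hr
    exact hflat X (hX.trans sdiff_subset) hr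
  have heI : M.Indep {e} := by
    rw [_root_.Matroid.indep_singleton, ← _root_.Matroid.not_isLoop_iff heE]
    intro hloop
    have hC₀e : C₀ = {e} := hloop.eq_of_isCircuit_mem hC₀.1 heC₀
    have := hC₀.2
    rw [hC₀e, ncard_singleton] at this
    omega
  set S₁ := {C : Set α | M.IsCircuit C ∧ C.ncard = 4 ∧ e ∈ C} with hS₁
  set S₂ := {C : Set α | M.IsCircuit C ∧ C.ncard = 4 ∧ e ∉ C} with hS₂
  have hsplit : S ⊆ S₁ ∪ S₂ := by
    intro C hC
    by_cases h : e ∈ C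
    · exact Or.inl ⟨hC.1, hC.2, h⟩
    · exact Or.inr ⟨hC.1, hC.2, h⟩
  have hS₁fin : S₁.Finite := hSfin.subset (fun C hC => ⟨hC.1, hC.2.1⟩)
  have hS₂fin : S₂.Finite := hSfin.subset (fun C hC => ⟨hC.1, hC.2.1⟩)
  have h1 : S₁.ncard + d ≤ d * d + 4 := ncard_fourThrough_add_le_sq_add_four M hflat heI hd
  have h2c : 3 * S₂.ncard ≤ d' * d' * d' + 11 * d' := by
    have hsub : S₂ ⊆ {C : Set α | (M ＼ {e}).IsCircuit C ∧ C.ncard = 4} := by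
      intro C hC
      exact ⟨_root_.Matroid.delete_isCircuit_iff.2 ⟨hC.1, disjoint_singleton_right.2 hC.2.2⟩, hC.2.1⟩
    calc 3 * S₂.ncard ≤ 3 * {C : Set α | (M ＼ {e}).IsCircuit C ∧ C.ncard = 4}.ncard := by
          apply Nat.mul_le_mul_left
          exact ncard_le_ncard hsub
            ((M ＼ {e}).ground_finite.finite_subsets.subset (fun C hC => hC.1.subset_ground))
      _ ≤ _ := ih _ hdelE (M ＼ {e}) rfl hflat' d' hd'enc
  have h3 : S.ncard ≤ S₁.ncard + S₂.ncard :=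
    (ncard_le_ncard hsplit (hS₁fin.union hS₂fin)).trans (ncard_union_le _ _)
  subst hdd'
  nlinarith [h1, h2c, h3]

end S1

end PercRepro
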